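import Literature.AlgebraicGeometry.HodgeTheory.IntegralLefschetzOneOne
import Summits.HodgeConjecture.HodgeConjecture.Theorems.GenericDivisibilityHodgeClassesGenericallyDivisibleTensorMiddleConiveau

/-!
# Route GenericDivisibility — crux `HodgeClassesGenericallyDivisible` (C1, item stmt-HodgeConjecture-18466):
# the sector `Y ⊗ S'` with `S'` a surface of geometric genus zero (all of `H²(S'(ℂ); ℤ)` of type `(1,1)`)

Instance of the product sector `…TensorMiddleConiveau` with a SURFACE factor: if `S'` is a smooth
projective surface whose integral cohomology is free and ALL of whose integral degree-`2` classes are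
of Hodge type `(1,1)` (`p_g(S') = 0`: rational surfaces, ruled surfaces, …), then every class of
`H²(S'(ℂ); ℤ)` dies on the complex points of a non-empty Zariski open — the tree's INTEGRAL Lefschetz
theorem on `(1,1)`-classes in Zariski-local form (`integralLefschetzOneOne`, Voisin I Thm. 11.30 with
Rem. 7.9) — i.e. `S'` has middle integral coniveau one, so C1 holds for EVERY integral class on the
`2p`-folds `Y ⊗ S'` (`dim Y = 2p - 2`), Hodge-blind, with `y = 0`:

* `genericDivisibility_tensorSurface_restrict_eq_zero_of_forall_oneOne` — every class of
  `Hᵏ((Y ⊗ S')(ℂ); ℤ)`, `k ≥ dim Y + 2`, dies on the complex points of a non-empty Zariski open;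
* `stub_hodgeClassesGenericallyDivisible_tensorSurface_of_forall_oneOne` — the registered sub-goal of
  the item.

For two surfaces `S ⊗ S'` this settles C1 whenever ONE factor has `p_g = 0` and free cohomology; the
remaining product case is `p_g(S), p_g(S') > 0` — the Künneth component `H²(S) ⊗ H²(S')`, i.e. the
`K3 × K3` problem. The crux itself is untouched (open problem).

References: C. Voisin, *Hodge Theory and Complex Algebraic Geometry I* (2002), Thm. 11.30, Rem. 7.9
[VoisinHodgeI2002]; A. Hatcher, *Algebraic Topology* (2002), Thm. 3.16 [HatcherAT2002];
A. Andreotti, T. Frankel, Ann. of Math. 69 (1959), Thm. 1 [AndreottiFrankel1959].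
-/

set_option linter.dupNamespace false

noncomputable section

namespace Summit.HodgeConjecture.HodgeConjecture.Theorems

open CategoryTheory MonoidalCategory
open Literature.AlgebraicGeometry.Motives Literature.AlgebraicGeometry.HodgeTheory
  Literature.AlgebraicTopology.SingularHomology
open Summit.HodgeConjecture.HodgeConjecture.Theses.GenericDivisibility

/-- **Generic vanishing on `Y ⊗ S'` for a surface `S'` with free cohomology all of whose integral
degree-`2` classes are `(1,1)`.** Every class of `Hᵏ((Y ⊗ S')(ℂ); ℤ)`, `k ≥ dim Y + 2`, dies on the
complex points of a non-empty Zariski open (`integralLefschetzOneOne` supplies middle integral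
coniveau one on `S'`; then `genericDivisibility_tensor_restrict_eq_zero_of_middleConiveau`).
[cite: VoisinHodgeI2002, Thm. 11.30 and Rem. 7.9] [cite: HatcherAT2002, §3.2 Thm. 3.16]
[cite: AndreottiFrankel1959, Thm. 1] -/
theorem genericDivisibility_tensorSurface_restrict_eq_zero_of_forall_oneOne {d : ℕ}
    {Y S' : SchemeOver ℂ} (hY : IsSmoothProjective d Y) (hS' : IsSmoothProjective 2 S')
    (hfree : ∀ j : ℕ, j ≤ 2 * 2 → Module.Free ℤ (singularCohomology ℤ ℤ (ComplexPoints S') j))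
    (h11 : ∀ x : singularCohomology ℤ ℤ (ComplexPoints S') 2,
      IsOfHodgeType 2 S' 2 1 1 (singularCohomology.ringChange (Int.castRingHom ℂ) (ComplexPoints S') 2 x))
    {k : ℕ} (hk : d + 2 ≤ k) (z : singularCohomology ℤ ℤ (ComplexPoints (Y ⊗ S')) k) :
    ∃ Z : Set (Y ⊗ S').left, IsClosed Z ∧ Z ≠ Set.univ ∧
      singularCohomology.map ℤ ℤ
        (⟨Subtype.val, continuous_subtype_val⟩ :
          C(complexPointsCompl (Y ⊗ S') Z, ComplexPoints (Y ⊗ S'))) k z = 0 :=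
  genericDivisibility_tensor_restrict_eq_zero_of_middleConiveau hY hS' hfree
    (fun e ↦ integralLefschetzOneOne hS' e (h11 e)) hk z

/-- **Registered sub-goal `stub_hodgeClassesGenericallyDivisible_tensorSurface_of_forall_oneOne` of
the crux item stmt-HodgeConjecture-18466** — the item's statement for the `2p`-folds `X = Y ⊗ S'`
(`dim Y = 2p - 2`, `S'` a smooth projective surface with free integral cohomology all of whose
integral degree-`2` classes are of type `(1,1)`), for ALL integral classes and with `y = 0`.
[cite: VoisinHodgeI2002, Thm. 11.30 and Rem. 7.9] [cite: HatcherAT2002, §3.2 Thm. 3.16] -/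
theorem stub_hodgeClassesGenericallyDivisible_tensorSurface_of_forall_oneOne :
    ∀ ⦃p d : ℕ⦄ ⦃Y S' : SchemeOver ℂ⦄, 1 ≤ p → d + 2 = 2 * p → IsSmoothProjective d Y →
      IsSmoothProjective 2 S' →
      (∀ j : ℕ, j ≤ 2 * 2 → Module.Free ℤ (singularCohomology ℤ ℤ (ComplexPoints S') j)) →
      (∀ x : singularCohomology ℤ ℤ (ComplexPoints S') 2, IsOfHodgeType 2 S' 2 1 1
        (singularCohomology.ringChange (Int.castRingHom ℂ) (ComplexPoints S') 2 x)) →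
      ∀ z : singularCohomology ℤ ℤ
        (ComplexPoints (CategoryTheory.MonoidalCategoryStruct.tensorObj Y S')) (2 * p),
        ∀ m : ℕ, 1 ≤ m →
          ∃ Z : Set (CategoryTheory.MonoidalCategoryStruct.tensorObj Y S').left,
            IsClosed Z ∧ Z ≠ Set.univ ∧
            ∃ y : singularCohomology ℤ ℤ
              (complexPointsCompl (CategoryTheory.MonoidalCategoryStruct.tensorObj Y S') Z) (2 * p),
              m • y = singularCohomology.map ℤ ℤ
                (⟨Subtype.val, continuous_subtype_val⟩ :
                  C(complexPointsCompl (CategoryTheory.MonoidalCategoryStruct.tensorObj Y S') Z,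
                    ComplexPoints (CategoryTheory.MonoidalCategoryStruct.tensorObj Y S'))) (2 * p) z := by
  intro p d Y S' hp hd hY hS' hfree h11 z m _
  obtain ⟨Z, hZ, hZne, h0⟩ := genericDivisibility_tensorSurface_restrict_eq_zero_of_forall_oneOne hY hS'
    hfree h11 (k := 2 * p) (by omega) z
  exact ⟨Z, hZ, hZne, 0, by rw [nsmul_zero]; exact h0.symm⟩

end Summit.HodgeConjecture.HodgeConjecture.Theorems

end
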